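import Summits.CriticalPhenomena.PercolationContinuityZ3.Theorems.PercNearOneGluingNoHeavyLowerTailPivotalDualRowR3
import Mathlib.Tactic.Linarith
import Mathlib.Tactic.Positivity
import Mathlib.Tactic.Ring
import HarnessLib

/-!
# `NoHeavyLowerTail` (stmt-CriticalPhenomena-4575) — the pivotal refinement, VII: the row dR4 (sharpened)
# `T_a · (u_a + T_c) ≤ u_b · (T₀ + T_b)` on EVERY finite weighted graph

Support file (prover prim-gen-kcluster gen 44; `--supports stmt-CriticalPhenomena-4575`).  No named facts, no sorries, no definitions.

Cells as in part VI (`…PivotalDualRowR3.lean`): `H_a = (pivEv a b c)ᶜ = {b ~ c off a}`, `H_b = {a ~ c off b}`, `H_c = {a ~ b off c}`;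
`q` (none), `u_x` (only `H_x`), `T_a = P(H_b H_c ¬H_a)` (`abc`, `a` pivotal), `T_b`, `T_c`, `T₀ = P(H_a H_b H_c)`.

**THEOREM dR4⁺ (`dualRowR4_PrW`).**  For pairwise distinct terminals, `T_a · (u_a + T_c) ≤ u_b · (T₀ + T_b)`; in particular the row
dR4 `u_a · T_a ≤ u_b · (T₀ + T_b)` conjectured in KCLUSTER-gen43 §2 (census kit j135998 / j136943), which is dR4⁺ minus the term `T_a T_c ≥ 0`
(`dualRowR4_weak_PrW`).  Conditional reading: `P(H_c | H_b, ¬H_a) ≤ P(H_c | H_a)` — given that `a ~ c` off `b` but NOT `b ~ c` off `a`, the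
connection `a ~ b` off `c` is less likely than given `b ~ c` off `a`.  dR4⁺ is an equality on every blob network.

PROOF (degree three).  With `α = H_b`, `β = H_a`, `W = H_c`:  `P(W | α¬β) ≤ P(W | ¬β)` is the BHK row at `a` (`PivotalBHK.bhkRow_PrW`,
[cite: VandenbergHaggstromKahn2005, Thm. 1.4 (p. 7)]: given `¬β`, `α` and `W` are negatively correlated); `P(W | ¬β) ≤ P(W) ≤ P(W | β)` is Harris
twice.  Hence `P(Wα¬β) · P(β) ≤ P(α¬β) · P(Wβ)`, i.e. `T_a (u_a + T_b + T_c + T₀) ≤ (u_b + T_a)(T_b + T₀)`, which is dR4⁺.  Division-free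
real core `dualRowR4_real`; event bookkeeping = the three-event dictionary (part IV) exactly as in part VI.
-/

noncomputable section

namespace Summit.CriticalPhenomena.PercolationContinuityZ3.Theorems

namespace PivotalBHK

open Finset MeasureTheory Literature.Probability.Percolation Literature.Probability.Percolation.DecisionTree
open Gladkov ThreePointGamma CovTauStarN ThreePointLB
open scoped Classical

variable {V : Type*} [Fintype V] [DecidableEq V]

/-! ### The real-arithmetic core -/

section Real

omit [Fintype V] [DecidableEq V] in
/-- **The chain behind dR4⁺.**  With `nβ = P(¬β) = q + u_b + u_c + T_a`, `Pβ = P(β) = u_a + T_b + T_c + T₀`, `w = P(W)`: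
the BHK row at `a`, `P(W¬β) ≤ P(W) P(¬β)` and `P(W) P(β) ≤ P(Wβ) = T_b + T₀` give `T_a (u_a + T_c) ≤ u_b (T₀ + T_b)`. [this work] -/
theorem dualRowR4_real {q ua ub uc Ta Tb Tc T0 w nβ Pβ : ℝ}
    (hq : 0 ≤ q) (hua : 0 ≤ ua) (hub : 0 ≤ ub) (huc : 0 ≤ uc) (hTa : 0 ≤ Ta) (hTb : 0 ≤ Tb) (hTc : 0 ≤ Tc) (hT0 : 0 ≤ T0)
    (hrowa : q * Ta ≤ ub * uc) (hnβ : nβ = q + ub + uc + Ta) (hPβ : Pβ = ua + Tb + Tc + T0)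
    (hH2 : uc + Ta ≤ w * nβ) (hH3 : w * Pβ ≤ Tb + T0) :
    Ta * (ua + Tc) ≤ ub * (T0 + Tb) := by
  have hnβ0 : 0 ≤ nβ := by rw [hnβ]; positivity
  have hPβ0 : 0 ≤ Pβ := by rw [hPβ]; positivity
  -- the BHK row in conditional form
  have r1 : nβ * Ta ≤ (ub + Ta) * (uc + Ta) := by rw [hnβ]; nlinarith [hrowa]
  -- chain: nβ · T_a · P(β) ≤ (u_b + T_a)(u_c + T_a) P(β) ≤ (u_b + T_a) · w nβ · P(β) ≤ (u_b + T_a) · nβ · (T_b + T₀)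
  have c1 : (nβ * Ta) * Pβ ≤ ((ub + Ta) * (uc + Ta)) * Pβ := mul_le_mul_of_nonneg_right r1 hPβ0
  have c2 : ((ub + Ta) * (uc + Ta)) * Pβ ≤ ((ub + Ta) * (w * nβ)) * Pβ :=
    mul_le_mul_of_nonneg_right (mul_le_mul_of_nonneg_left hH2 (by positivity)) hPβ0
  have c3 : ((ub + Ta) * nβ) * (w * Pβ) ≤ ((ub + Ta) * nβ) * (Tb + T0) := mul_le_mul_of_nonneg_left hH3 (by positivity)
  have key : nβ * (Ta * Pβ) ≤ nβ * ((ub + Ta) * (Tb + T0)) := by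
    have e1 : (nβ * Ta) * Pβ = nβ * (Ta * Pβ) := by ring
    have e2 : ((ub + Ta) * (w * nβ)) * Pβ = ((ub + Ta) * nβ) * (w * Pβ) := by ring
    have e3 : ((ub + Ta) * nβ) * (Tb + T0) = nβ * ((ub + Ta) * (Tb + T0)) := by ring
    rw [← e1, ← e3]
    calc (nβ * Ta) * Pβ ≤ ((ub + Ta) * (uc + Ta)) * Pβ := c1
      _ ≤ ((ub + Ta) * (w * nβ)) * Pβ := c2
      _ = ((ub + Ta) * nβ) * (w * Pβ) := e2
      _ ≤ ((ub + Ta) * nβ) * (Tb + T0) := c3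
  by_cases h0 : nβ = 0
  · have hTa0 : Ta = 0 := by rw [hnβ] at h0; linarith
    rw [hTa0, zero_mul]; positivity
  · have hpos : 0 < nβ := lt_of_le_of_ne hnβ0 (Ne.symm h0)
    have h := le_of_mul_le_mul_left key hpos
    rw [hPβ] at h
    nlinarith [h, mul_nonneg hTa hTb, mul_nonneg hTa hT0]

end Real

/-! ### THEOREM dR4⁺ -/

section Main

variable (D : Finset (Sym2 V)) {p : Sym2 V → ℝ} (hp0 : ∀ e, 0 ≤ p e) (hp1 : ∀ e, p e ≤ 1) {a b c : V}
include hp0 hp1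

/-- **THEOREM dR4⁺, three-event form.**  With `Pa = pivEv a b c = ¬H_a`, `Pb = ¬H_b`, `Pc = ¬H_c` (pairwise distinct terminals):
`P(Pa ∩ Pbᶜ ∩ Pcᶜ) · (P(Paᶜ ∩ Pb ∩ Pc) + P(Paᶜ ∩ Pbᶜ ∩ Pc)) ≤ P(Pa ∩ Pbᶜ ∩ Pc) · (P(Paᶜ ∩ Pbᶜ ∩ Pcᶜ) + P(Paᶜ ∩ Pb ∩ Pcᶜ))`,
i.e. `T_a (u_a + T_c) ≤ u_b (T₀ + T_b)`, i.e. `P(H_c | H_b ¬H_a) ≤ P(H_c | H_a)`. [this work] -/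
theorem dualRowR4_H (hab : a ≠ b) (hac : a ≠ c) (hbc : b ≠ c) :
    PrW D p (pivEv a b c ∩ (pivEv b a c)ᶜ ∩ (pivEv c a b)ᶜ) *
        (PrW D p ((pivEv a b c)ᶜ ∩ pivEv b a c ∩ pivEv c a b) + PrW D p ((pivEv a b c)ᶜ ∩ (pivEv b a c)ᶜ ∩ pivEv c a b)) ≤
      PrW D p (pivEv a b c ∩ (pivEv b a c)ᶜ ∩ pivEv c a b) *
        (PrW D p ((pivEv a b c)ᶜ ∩ (pivEv b a c)ᶜ ∩ (pivEv c a b)ᶜ) + PrW D p ((pivEv a b c)ᶜ ∩ pivEv b a c ∩ (pivEv c a b)ᶜ)) := by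
  have hba : b ≠ a := fun h => hab h.symm
  -- the BHK row at `a`, translated into the atoms of the three events by the dictionary of part IV
  have Dq : ((conn a b)ᶜ ∩ (conn a c)ᶜ ∩ (conn b c)ᶜ : Set (Finset (Sym2 V))) = pivEv a b c ∩ pivEv b a c ∩ pivEv c a b :=
    apart_eq hab hac hbc
  have DTa : (conn a b ∩ conn a c ∩ pivEv a b c : Set (Finset (Sym2 V))) = pivEv a b c ∩ (pivEv b a c)ᶜ ∩ (pivEv c a b)ᶜ := by
    rw [Ta_eq hab hac hbc]
    ext K; simp only [Set.mem_inter_iff, Set.mem_compl_iff]; tauto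
  have Dub : (conn a c ∩ (conn a b)ᶜ : Set (Finset (Sym2 V))) = pivEv a b c ∩ (pivEv b a c)ᶜ ∩ pivEv c a b := by
    have h := Ua_eq' hba hbc hac
    rw [conn_comm b a, pivEv_comm c b a] at h
    rw [h]
    ext K; simp only [Set.mem_inter_iff, Set.mem_compl_iff]; tauto
  have Duc : (conn a b ∩ (conn a c)ᶜ : Set (Finset (Sym2 V))) = pivEv a b c ∩ pivEv b a c ∩ (pivEv c a b)ᶜ := by
    have hca : c ≠ a := fun h => hac h.symm
    have hcb : c ≠ b := fun h => hbc h.symm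
    have h := Ua_eq' hca hcb hab
    rw [conn_comm c a, pivEv_comm a c b, pivEv_comm b c a] at h
    rw [h]
    ext K; simp only [Set.mem_inter_iff, Set.mem_compl_iff]; tauto
  have hA := bhkRow_PrW hp0 hp1 D hab hac
  rw [Dq, DTa, Dub, Duc] at hA
  -- the three decreasing events and the atoms
  set Pa : Set (Finset (Sym2 V)) := pivEv a b c with hPa
  set Pb : Set (Finset (Sym2 V)) := pivEv b a c with hPb
  set Pc : Set (Finset (Sym2 V)) := pivEv c a b with hPc
  have lPa : IsLowerSet Pa := isLowerSet_pivEv a b c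
  have lPc : IsLowerSet Pc := isLowerSet_pivEv c a b
  set q := PrW D p (Pa ∩ Pb ∩ Pc) with hq
  set ua := PrW D p (Paᶜ ∩ Pb ∩ Pc) with hua
  set ub := PrW D p (Pa ∩ Pbᶜ ∩ Pc) with hub
  set uc := PrW D p (Pa ∩ Pb ∩ Pcᶜ) with huc
  set Ta := PrW D p (Pa ∩ Pbᶜ ∩ Pcᶜ) with hTa
  set Tb := PrW D p (Paᶜ ∩ Pb ∩ Pcᶜ) with hTb
  set Tc := PrW D p (Paᶜ ∩ Pbᶜ ∩ Pc) with hTc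
  set T0 := PrW D p (Paᶜ ∩ Pbᶜ ∩ Pcᶜ) with hT0
  have nn := fun X => PrW_nonneg D hp0 hp1 (p := p) X
  -- splitting identities
  have sp := PrW_eq_inter_add_inter_compl D p
  have S8 : PrW D p (Pa ∩ Pb) = q + uc := sp (Pa ∩ Pb) Pc
  have S2 : PrW D p (Pa ∩ Pbᶜ) = ub + Ta := sp (Pa ∩ Pbᶜ) Pc
  have S1 : PrW D p Pa = q + ub + uc + Ta := by rw [sp Pa Pb, S8, S2]; ring
  have S3 : PrW D p (Pa ∩ Pcᶜ) = uc + Ta := by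
    rw [sp (Pa ∩ Pcᶜ) Pb]
    have e1 : Pa ∩ Pcᶜ ∩ Pb = Pa ∩ Pb ∩ Pcᶜ := by
      ext K; simp only [Set.mem_inter_iff, Set.mem_compl_iff]; tauto
    have e2 : Pa ∩ Pcᶜ ∩ Pbᶜ = Pa ∩ Pbᶜ ∩ Pcᶜ := by
      ext K; simp only [Set.mem_inter_iff, Set.mem_compl_iff]; tauto
    rw [e1, e2]
  have S5 : PrW D p (Paᶜ ∩ Pb) = ua + Tb := sp (Paᶜ ∩ Pb) Pc
  have S7 : PrW D p (Paᶜ ∩ Pbᶜ) = Tc + T0 := sp (Paᶜ ∩ Pbᶜ) Pc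
  have S11 : PrW D p Paᶜ = ua + Tb + Tc + T0 := by
    rw [sp Paᶜ Pb, S5, S7]; ring
  have S13 : PrW D p (Paᶜ ∩ Pcᶜ) = Tb + T0 := by
    rw [sp (Paᶜ ∩ Pcᶜ) Pb]
    have e1 : Paᶜ ∩ Pcᶜ ∩ Pb = Paᶜ ∩ Pb ∩ Pcᶜ := by
      ext K; simp only [Set.mem_inter_iff, Set.mem_compl_iff]; tauto
    have e2 : Paᶜ ∩ Pcᶜ ∩ Pbᶜ = Paᶜ ∩ Pbᶜ ∩ Pcᶜ := by
      ext K; simp only [Set.mem_inter_iff, Set.mem_compl_iff]; tauto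
    rw [e1, e2]
  have Stot : PrW D p Pa + PrW D p Paᶜ = 1 := by
    rw [← PrW_union D p disjoint_compl_right, Set.union_compl_self, PrW_univ]
  have S14 : PrW D p (Pa ∩ Pcᶜ) + PrW D p (Paᶜ ∩ Pcᶜ) = PrW D p Pcᶜ := by
    rw [sp Pcᶜ Pa, Set.inter_comm Pcᶜ Pa, Set.inter_comm Pcᶜ Paᶜ]
  -- Harris: `P(W¬β) ≤ P(W) P(¬β)`, and hence (complements) `P(W) P(β) ≤ P(Wβ)`
  have H2 : uc + Ta ≤ PrW D p Pcᶜ * PrW D p Pa := by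
    have h := PrW_inter_le_of_lower_upper D hp0 hp1 lPa lPc.compl
    rw [S3] at h
    linarith [h, mul_comm (PrW D p Pa) (PrW D p Pcᶜ)]
  have H3 : PrW D p Pcᶜ * PrW D p Paᶜ ≤ Tb + T0 := by
    rw [← S13]
    have hc : PrW D p Paᶜ = 1 - PrW D p Pa := by linarith [Stot]
    have e : PrW D p Pcᶜ * PrW D p Paᶜ = PrW D p Pcᶜ - PrW D p Pcᶜ * PrW D p Pa := by
      rw [hc]; ring
    rw [e]
    linarith [H2, S14, S3]
  -- conclude with the real-arithmetic chain
  exact dualRowR4_real (nn _) (nn _) (nn _) (nn _) (nn _) (nn _) (nn _) (nn _) hA S1 S11 H2 H3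

/-- **THEOREM dR4⁺, cell form.**  On the coordinates `D` with weights `p ∈ [0,1]`, for pairwise distinct `a, b, c`:
`T_a · (u_a + T_c) ≤ u_b · (T₀ + T_b)`, where `T_x = P(all joined ∧ x pivotal)`, `u_a = P(bc|a)`, `u_b = P(ac|b)`,
`T₀ = P(all joined, no terminal pivotal)`.  BHK row at `a` + Harris twice. [this work] -/
theorem dualRowR4_PrW (hab : a ≠ b) (hac : a ≠ c) (hbc : b ≠ c) :
    PrW D p (conn a b ∩ conn a c ∩ pivEv a b c) *
        (PrW D p (conn b c ∩ (conn a b)ᶜ) + PrW D p (conn c a ∩ conn c b ∩ pivEv c a b)) ≤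
      PrW D p (conn a c ∩ (conn a b)ᶜ) *
        (PrW D p (conn a b ∩ conn a c ∩ ((pivEv a b c)ᶜ ∩ (pivEv b a c)ᶜ ∩ (pivEv c a b)ᶜ)) +
          PrW D p (conn b a ∩ conn b c ∩ pivEv b a c)) := by
  have hba : b ≠ a := fun h => hab h.symm
  have hca : c ≠ a := fun h => hac h.symm
  have hcb : c ≠ b := fun h => hbc h.symm
  have DTa : (conn a b ∩ conn a c ∩ pivEv a b c : Set (Finset (Sym2 V))) = pivEv a b c ∩ (pivEv b a c)ᶜ ∩ (pivEv c a b)ᶜ := by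
    rw [Ta_eq hab hac hbc]
    ext K; simp only [Set.mem_inter_iff, Set.mem_compl_iff]; tauto
  have DTb : (conn b a ∩ conn b c ∩ pivEv b a c : Set (Finset (Sym2 V))) = (pivEv a b c)ᶜ ∩ pivEv b a c ∩ (pivEv c a b)ᶜ := by
    rw [Ta_eq hba hbc hac, pivEv_comm c b a]
    ext K; simp only [Set.mem_inter_iff, Set.mem_compl_iff]; tauto
  have DTc : (conn c a ∩ conn c b ∩ pivEv c a b : Set (Finset (Sym2 V))) = (pivEv a b c)ᶜ ∩ (pivEv b a c)ᶜ ∩ pivEv c a b := by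
    rw [Ta_eq hca hcb hab, pivEv_comm a c b, pivEv_comm b c a]
  have Dua : (conn b c ∩ (conn a b)ᶜ : Set (Finset (Sym2 V))) = (pivEv a b c)ᶜ ∩ pivEv b a c ∩ pivEv c a b := Ua_eq' hab hac hbc
  have Dub : (conn a c ∩ (conn a b)ᶜ : Set (Finset (Sym2 V))) = pivEv a b c ∩ (pivEv b a c)ᶜ ∩ pivEv c a b := by
    have h := Ua_eq' hba hbc hac
    rw [conn_comm b a, pivEv_comm c b a] at h
    rw [h]
    ext K; simp only [Set.mem_inter_iff, Set.mem_compl_iff]; tauto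
  rw [DTa, DTb, DTc, Dua, Dub, T0_eq]
  exact dualRowR4_H D hp0 hp1 hab hac hbc

/-- **THEOREM dR4 (as conjectured in KCLUSTER-gen43 §2), cell form**: `u_a · T_a ≤ u_b · (T₀ + T_b)` — dR4⁺ minus `T_a T_c ≥ 0`. [this work] -/
theorem dualRowR4_weak_PrW (hab : a ≠ b) (hac : a ≠ c) (hbc : b ≠ c) :
    PrW D p (conn b c ∩ (conn a b)ᶜ) * PrW D p (conn a b ∩ conn a c ∩ pivEv a b c) ≤
      PrW D p (conn a c ∩ (conn a b)ᶜ) *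
        (PrW D p (conn a b ∩ conn a c ∩ ((pivEv a b c)ᶜ ∩ (pivEv b a c)ᶜ ∩ (pivEv c a b)ᶜ)) +
          PrW D p (conn b a ∩ conn b c ∩ pivEv b a c)) := by
  have h := dualRowR4_PrW D hp0 hp1 hab hac hbc
  have h1 := PrW_nonneg D hp0 hp1 (p := p) (conn a b ∩ conn a c ∩ pivEv a b c)
  have h2 := PrW_nonneg D hp0 hp1 (p := p) (conn c a ∩ conn c b ∩ pivEv c a b)
  nlinarith [h, mul_nonneg h1 h2]

end Main

end PivotalBHK

end Summit.CriticalPhenomena.PercolationContinuityZ3.Theorems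

end
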